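import Mathlib
import HarnessLib
import Literature.Analysis.FluidPDE.FirstIntegralTransportDefect
import Summits.NavierStokesRegularity.NavierStokesRegularity.Theorems.PoloidalWindowDoorLrcModEntireQ4SonicHotSheetSecondPins
import Summits.NavierStokesRegularity.NavierStokesRegularity.Theorems.PoloidalWindowDoorPoloidalWindowRigidityConstantShearSlice

/-!
# Route `PoloidalWindowDoor`, item `LrcModEntire` (stmt-NavierStokesRegularity-20428), cell (Q4-sonic) of the (TH) column, slot `stub_Q4sonicLineNeg` —
# THE SECOND-ORDER NORMAL FORM ON THE STRAIGHT HOT SHEET: `D²U₂(−1,·)(W)[u,w] = a(z)·⟪u,n⟫⟪w,n⟫`, `n = Je − d′(z)e₂`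

Cell ns-regularity-ideate, helper seat ns-k2-port-2 g8 under the LEAD of item 20428 (ns-poloidal-K2-p3 g16, pick 2026-08-29T17:26Z «HS3»);
`--supports stmt-NavierStokesRegularity-20428 --as helper`.  Memo `Cruxes/LrcModEntire/HOT-SHEET-port2g8.md` §2 and `T2B-g16-sonic.md` §2(b) («Hessian
`D²F₀ = λ N̂⊗N̂` with `N̂ ∝ Je − d′e₂` the (null) normal») in kernel form.  On the straight sonic sheet `W(s,z) = s·e + d(z)·Je + z·e₂` the slice Hessian of
`θ = U₂(−1,·)` kills both sheet tangents `e`, `d′Je + e₂` (`…Q4SonicHotSheetSecondPins.sonic_sheet_hessian_tangent_eq_zero`); a symmetric bilinear form on `ℝ³`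
with these two null vectors is a multiple of `n♭ ⊗ n♭`, `n := Je − d′e₂`:

* Part A (class-free algebra): `bilin_eq_rankOne_of_null_tangents` — `B` symmetric, `B(e,·) = 0`, `B(kJe + e₂,·) = 0`, `e` horizontal unit ⇒
  **`B(u,w) = B(Je,Je)·(u_J − k u₂)(w_J − k w₂)`** with `u_J := u₁e₀ − u₀e₁ = ⟪u,Je⟫`; `bilin_trace_of_null_tangents` — `B(e₀,e₀) + B(e₁,e₁) + B(e₂,e₂) = (1 + k²)·B(Je,Je)`.
* Part B (class level, straight sonic sheet; hypotheses as in `…Q4SonicHotSheetJet.sonic_sheet_thirdDeriv_webDirection_eq_zero`):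
  ★ `sonic_sheet_hessian_normalForm` — **`D²U₂(−1,·)(W p)[u][w] = a·(u_J − d′u₂)(w_J − d′w₂)`**, `a = D²U₂(−1,·)(W p)[Je][Je]`;
  ★ `sonic_sheet_laplacian_eq` — **`ΔU₂(−1,·)(W p) = (1 + d′(p₂)²)·a`** (so, on the characteristic sheet `d′² = −μ`, `= (1 − μ)·a`: `sonic_sheet_laplacian_eq_of_char`);
  ★ `sonic_sheet_pressure_eq` — for every classical pressure `P`: **`σ(∇P(−1,·))(W p)₂ = σ(1 + d′²)·a − |N|/2`**, both terms negative when `σa < 0`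
  (`…SecondPins.sonic_web_point_pressure`).
* Part C (any branch, point level): `sonic_web_point_fderiv_structure` — at a sonic web point of the slope slab the velocity gradient is a horizontal, symmetric,
  trace-free `2×2` block: `DU(−1)(W)e₂ = 0`, `(DU(−1)(W)h)₂ = 0`, `(DU(W)e₀)₁ = (DU(W)e₁)₀`, `(DU(W)e₀)₀ + (DU(W)e₁)₁ = 0` (gradient pin, slab slope law, poloidality,
  incompressibility).

WHAT THIS IS NOT: not a claim about Navier–Stokes regularity — structure of the hypothetical hot null sheet of the research slot `stub_Q4sonicLineNeg` (registry
twist_split v11); no stub is closed here; items 20428 / 19708 / 27893 OPEN.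
-/

noncomputable section

set_option linter.dupNamespace false
set_option linter.style.longLine false

namespace Summit.NavierStokesRegularity.NavierStokesRegularity.Theorems.PoloidalWindowDoorLrcModEntireQ4SonicHotSheetNormalForm

open Set Function Filter Topology Metric
open scoped RealInnerProductSpace InnerProductSpace Laplacian ContDiff
open Literature.Analysis Literature.Analysis.FluidPDE Literature.Analysis.UnboundedOperators
open Summit.NavierStokesRegularity.NavierStokesRegularity.Theorems
open Summit.NavierStokesRegularity.NavierStokesRegularity.Theorems.LocalSineTubeDoorProfileAlignedWindowRigidityAncient
open Summit.NavierStokesRegularity.NavierStokesRegularity.Theorems.PoloidalWindowDoorLrcModEntireQ4SonicHotSheet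
open Summit.NavierStokesRegularity.NavierStokesRegularity.Theorems.PoloidalWindowDoorLrcModEntireQ4SonicHotSheetSecondPins
open Summit.NavierStokesRegularity.NavierStokesRegularity.Theorems.PoloidalWindowDoorLrcModEntireTwistingTHHotPointPins
open Summit.NavierStokesRegularity.NavierStokesRegularity.Theorems.PoloidalWindowDoorLrcModEntireSheetFlattenTools
open Summit.NavierStokesRegularity.NavierStokesRegularity.Theorems.PoloidalWindowDoorLrcModEntireParallelWebsIdentity
open Summit.NavierStokesRegularity.NavierStokesRegularity.Theorems.PoloidalWindowDoorPoloidalWindowRigidityConstantShearSlice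

/-! ### Part A — class-free algebra: a symmetric bilinear form with two null sheet tangents is rank one -/

/-- ★ **Rank-one normal form.**  `B` a symmetric bilinear form on `ℝ³`, `e` a horizontal unit vector, `B(e,·) = 0` and `B(kJe + e₂,·) = 0` ⇒
`B(u,w) = B(Je,Je)·(u_J − k u₂)(w_J − k w₂)` with `u_J = u₁e₀ − u₀e₁` (the `Je`-coordinate of `u`). -/
theorem bilin_eq_rankOne_of_null_tangents (B : EuclideanSpace ℝ (Fin 3) →L[ℝ] EuclideanSpace ℝ (Fin 3) →L[ℝ] ℝ)
    (hsym : ∀ u w, B u w = B w u) {e : EuclideanSpace ℝ (Fin 3)} (he2 : e 2 = 0) (hunit : e 0 ^ 2 + e 1 ^ 2 = 1) {k : ℝ}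
    (he : ∀ w, B e w = 0) (hz : ∀ w, B (k • Jvec e + e2) w = 0) (u w : EuclideanSpace ℝ (Fin 3)) :
    B u w = B (Jvec e) (Jvec e) * ((u 1 * e 0 - u 0 * e 1 - k * u 2) * (w 1 * e 0 - w 0 * e 1 - k * w 2)) := by
  set a := B (Jvec e) (Jvec e) with ha
  -- the nine frame entries
  have hEe : B e e = 0 := he e
  have hEJ : B e (Jvec e) = 0 := he _
  have hE2 : B e e2 = 0 := he _
  have hJE : B (Jvec e) e = 0 := by rw [hsym]; exact he _
  have h2E : B e2 e = 0 := by rw [hsym]; exact he _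
  have hz' : ∀ w, k * B (Jvec e) w + B e2 w = 0 := by
    intro w; have h := hz w; simpa [map_add, map_smul] using h
  have h2J : B e2 (Jvec e) = -k * a := by linarith [hz' (Jvec e)]
  have hJ2 : B (Jvec e) e2 = -k * a := by rw [hsym]; exact h2J
  have h22 : B e2 e2 = k ^ 2 * a := by
    have h := hz' e2
    rw [hJ2] at h
    linear_combination h
  -- coordinates in the frame `{e, Je, e₂}` (as in `…Q4SonicHotSheetJet.frame_decomp`)
  have hdec : ∀ b : EuclideanSpace ℝ (Fin 3), b = (b 0 * e 0 + b 1 * e 1) • e + (b 1 * e 0 - b 0 * e 1) • Jvec e + b 2 • e2 := by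
    intro b
    ext i
    fin_cases i
    · simp [Jvec, e2]
      linear_combination -(b 0) * hunit
    · simp [Jvec, e2]
      linear_combination -(b 1) * hunit
    · simp [Jvec, e2, he2]
  conv_lhs => rw [hdec u, hdec w]
  simp only [map_add, map_smul, add_apply, smul_apply, smul_eq_mul, hEe, hEJ, hE2, hJE, h2E, h2J, hJ2, h22]
  ring

/-- **Trace of the rank-one form:** `B(e₀,e₀) + B(e₁,e₁) + B(e₂,e₂) = (1 + k²)·B(Je,Je)`. -/
theorem bilin_trace_of_null_tangents (B : EuclideanSpace ℝ (Fin 3) →L[ℝ] EuclideanSpace ℝ (Fin 3) →L[ℝ] ℝ)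
    (hsym : ∀ u w, B u w = B w u) {e : EuclideanSpace ℝ (Fin 3)} (he2 : e 2 = 0) (hunit : e 0 ^ 2 + e 1 ^ 2 = 1) {k : ℝ}
    (he : ∀ w, B e w = 0) (hz : ∀ w, B (k • Jvec e + e2) w = 0) :
    B (EuclideanSpace.single 0 (1 : ℝ)) (EuclideanSpace.single 0 (1 : ℝ)) + B (EuclideanSpace.single 1 (1 : ℝ)) (EuclideanSpace.single 1 (1 : ℝ)) +
        B (EuclideanSpace.single 2 (1 : ℝ)) (EuclideanSpace.single 2 (1 : ℝ)) = (1 + k ^ 2) * B (Jvec e) (Jvec e) := by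
  have h22 : B e2 e2 = k ^ 2 * B (Jvec e) (Jvec e) := by
    rw [bilin_eq_rankOne_of_null_tangents B hsym he2 hunit he hz e2 e2]
    simp [e2]; ring
  rw [← bilin_frame_trace B he2 hunit, he e]
  change 0 + B (Jvec e) (Jvec e) + B e2 e2 = _
  rw [h22]; ring

/-! ### Part B — class level: the straight sonic sheet of the hull element -/

variable {C : ℝ} {U : ℝ → EuclideanSpace ℝ (Fin 3) → EuclideanSpace ℝ (Fin 3)} {Γ νΓ : ℝ → EuclideanSpace ℝ (Fin 3)} {R : ℝ → ℝ → ℝ}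
  {σ r δ : ℝ}

/-- **The two null tangents and the symmetry of the slice Hessian at a point of the straight sonic sheet** (wiring of
`…Q4SonicHotSheetSecondPins.sonic_sheet_hessian_tangent_eq_zero` for the parallel web `W(q) = q₁·e + d(q₂)·Je + q₂·e₂`). -/
theorem sonic_sheet_null_tangents (hUrate : HasTypeITimeDecay C U) (hUcont : ContinuousOn (uncurry U) (Iio (0 : ℝ) ×ˢ univ))
    (hUmild : ∀ s t : ℝ, s < t → t < 0 → ∀ x, U t x = heatExtension (U s) (t - s) x - oseenDuhamel 1 s U U t x)
    (hUhotbd : ∀ t < 0, ∀ x, Real.sqrt (-t) * |U t x 2| ≤ |U (-1) 0 2|)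
    (hσ : σ = 1 ∨ σ = -1) (hσN : σ * U (-1) 0 2 = |U (-1) 0 2|) (hΓhot : ∀ s, U (-1) (Γ s) 2 = U (-1) 0 2)
    (hr : 0 < r) (hδ : 0 < δ)
    (hweb : ∀ z₀ : ℝ, |z₀| < δ → ∀ s₀ : ℝ, ∃ n₀ ∈ Ioo (-r) r,
      σ * U (-1) (Γ s₀ + n₀ • νΓ s₀ + z₀ • EuclideanSpace.single 2 (1 : ℝ)) 2 = R 0 z₀ ∧
      (∀ n ∈ Icc (-r) r, n ≠ n₀ → σ * U (-1) (Γ s₀ + n • νΓ s₀ + z₀ • EuclideanSpace.single 2 (1 : ℝ)) 2 < R 0 z₀))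
    (hson : ∃ a b : ℝ, ∀ z : ℝ, |z| < δ → R 0 z = a + b * z)
    (e : EuclideanSpace ℝ (Fin 3)) {d : ℝ → ℝ} {p : ℝ × ℝ} (hd : DifferentiableAt ℝ d p.2) (hp : |p.2| < δ)
    (hGval : ∀ᶠ q in 𝓝 p, σ * U (-1) (webMap e (fun q : ℝ × ℝ => d q.2) q) 2 = R 0 q.2) :
    (∀ u w, fderiv ℝ (fderiv ℝ (fun x => U (-1) x 2)) (webMap e (fun q : ℝ × ℝ => d q.2) p) u w =
        fderiv ℝ (fderiv ℝ (fun x => U (-1) x 2)) (webMap e (fun q : ℝ × ℝ => d q.2) p) w u) ∧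
      (∀ w, fderiv ℝ (fderiv ℝ (fun x => U (-1) x 2)) (webMap e (fun q : ℝ × ℝ => d q.2) p) e w = 0) ∧
      (∀ w, fderiv ℝ (fderiv ℝ (fun x => U (-1) x 2)) (webMap e (fun q : ℝ × ℝ => d q.2) p) (deriv d p.2 • Jvec e + e2) w = 0) := by
  have hm1 : (-1 : ℝ) < 0 := by norm_num
  set G : ℝ × ℝ → ℝ := fun q => d q.2 with hG
  -- regularity and symmetry
  have hUan : AnalyticOnNhd ℝ (U (-1)) univ := analyticOnNhd_slice hUcont (bdd_of_hasTypeITimeDecay hUrate) hUmild hm1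
  have hθan : AnalyticOnNhd ℝ (fun y => U (-1) y 2) univ := fun x _ =>
    ((EuclideanSpace.proj (𝕜 := ℝ) (2 : Fin 3)).analyticAt _).comp (hUan x (mem_univ _))
  have hθ2 : ContDiff ℝ 2 (fun y => U (-1) y 2) := hθan.contDiff
  refine ⟨fun u w => (hθ2.contDiffAt.isSymmSndFDerivAt (by simp)) u w, ?_, ?_⟩
  -- the web map: `DG(p)h = d′(p₂)·h₂`
  · have hGp' : HasFDerivAt G ((ContinuousLinearMap.smulRight (1 : ℝ →L[ℝ] ℝ) (deriv d p.2)).comp (ContinuousLinearMap.snd ℝ ℝ ℝ)) p :=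
      hd.hasDerivAt.hasFDerivAt.comp p hasFDerivAt_snd
    intro w
    have h := (sonic_sheet_hessian_tangent_eq_zero hUrate hUcont hUmild hUhotbd hσ hσN hΓhot hr hδ hweb hson e hp hGp'.differentiableAt hGval
      ((1 : ℝ), (0 : ℝ)) w).1
    rw [hGp'.fderiv] at h
    simpa using h
  · have hGp' : HasFDerivAt G ((ContinuousLinearMap.smulRight (1 : ℝ →L[ℝ] ℝ) (deriv d p.2)).comp (ContinuousLinearMap.snd ℝ ℝ ℝ)) p :=
      hd.hasDerivAt.hasFDerivAt.comp p hasFDerivAt_snd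
    intro w
    have h := (sonic_sheet_hessian_tangent_eq_zero hUrate hUcont hUmild hUhotbd hσ hσN hΓhot hr hδ hweb hson e hp hGp'.differentiableAt hGval
      ((0 : ℝ), (1 : ℝ)) w).1
    rw [hGp'.fderiv] at h
    simpa using h

/-- ★ **SECOND-ORDER NORMAL FORM ON THE STRAIGHT SONIC SHEET.**  In the sonic cell over a straight branch with parallel web offset `d` (web points
`W(q) = q₁·e + d(q₂)·Je + q₂·e₂` carrying the ridge height for `q` near `p`, `|p₂| < δ`), `e` a horizontal unit vector, `d` differentiable at `p₂`:
`D²U₂(−1,·)(W p)[u][w] = a·(u_J − d′(p₂)u₂)(w_J − d′(p₂)w₂)` with `a = D²U₂(−1,·)(W p)[Je][Je]`, `u_J = u₁e₀ − u₀e₁`. -/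
theorem sonic_sheet_hessian_normalForm (hUrate : HasTypeITimeDecay C U) (hUcont : ContinuousOn (uncurry U) (Iio (0 : ℝ) ×ˢ univ))
    (hUmild : ∀ s t : ℝ, s < t → t < 0 → ∀ x, U t x = heatExtension (U s) (t - s) x - oseenDuhamel 1 s U U t x)
    (hUhotbd : ∀ t < 0, ∀ x, Real.sqrt (-t) * |U t x 2| ≤ |U (-1) 0 2|)
    (hσ : σ = 1 ∨ σ = -1) (hσN : σ * U (-1) 0 2 = |U (-1) 0 2|) (hΓhot : ∀ s, U (-1) (Γ s) 2 = U (-1) 0 2)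
    (hr : 0 < r) (hδ : 0 < δ)
    (hweb : ∀ z₀ : ℝ, |z₀| < δ → ∀ s₀ : ℝ, ∃ n₀ ∈ Ioo (-r) r,
      σ * U (-1) (Γ s₀ + n₀ • νΓ s₀ + z₀ • EuclideanSpace.single 2 (1 : ℝ)) 2 = R 0 z₀ ∧
      (∀ n ∈ Icc (-r) r, n ≠ n₀ → σ * U (-1) (Γ s₀ + n • νΓ s₀ + z₀ • EuclideanSpace.single 2 (1 : ℝ)) 2 < R 0 z₀))
    (hson : ∃ a b : ℝ, ∀ z : ℝ, |z| < δ → R 0 z = a + b * z)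
    {e : EuclideanSpace ℝ (Fin 3)} (he2 : e 2 = 0) (hunit : e 0 ^ 2 + e 1 ^ 2 = 1) {d : ℝ → ℝ} {p : ℝ × ℝ}
    (hd : DifferentiableAt ℝ d p.2) (hp : |p.2| < δ)
    (hGval : ∀ᶠ q in 𝓝 p, σ * U (-1) (webMap e (fun q : ℝ × ℝ => d q.2) q) 2 = R 0 q.2) (u w : EuclideanSpace ℝ (Fin 3)) :
    fderiv ℝ (fderiv ℝ (fun x => U (-1) x 2)) (webMap e (fun q : ℝ × ℝ => d q.2) p) u w =
      fderiv ℝ (fderiv ℝ (fun x => U (-1) x 2)) (webMap e (fun q : ℝ × ℝ => d q.2) p) (Jvec e) (Jvec e) *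
        ((u 1 * e 0 - u 0 * e 1 - deriv d p.2 * u 2) * (w 1 * e 0 - w 0 * e 1 - deriv d p.2 * w 2)) := by
  obtain ⟨hsym, he, hz⟩ := sonic_sheet_null_tangents hUrate hUcont hUmild hUhotbd hσ hσN hΓhot hr hδ hweb hson e hd hp hGval
  exact bilin_eq_rankOne_of_null_tangents _ hsym he2 hunit he hz u w

/-- ★ **THE LAPLACIAN ON THE STRAIGHT SONIC SHEET:** `ΔU₂(−1,·)(W p) = (1 + d′(p₂)²)·D²U₂(−1,·)(W p)[Je][Je]`. -/
theorem sonic_sheet_laplacian_eq (hUrate : HasTypeITimeDecay C U) (hUcont : ContinuousOn (uncurry U) (Iio (0 : ℝ) ×ˢ univ))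
    (hUmild : ∀ s t : ℝ, s < t → t < 0 → ∀ x, U t x = heatExtension (U s) (t - s) x - oseenDuhamel 1 s U U t x)
    (hUhotbd : ∀ t < 0, ∀ x, Real.sqrt (-t) * |U t x 2| ≤ |U (-1) 0 2|)
    (hσ : σ = 1 ∨ σ = -1) (hσN : σ * U (-1) 0 2 = |U (-1) 0 2|) (hΓhot : ∀ s, U (-1) (Γ s) 2 = U (-1) 0 2)
    (hr : 0 < r) (hδ : 0 < δ)
    (hweb : ∀ z₀ : ℝ, |z₀| < δ → ∀ s₀ : ℝ, ∃ n₀ ∈ Ioo (-r) r,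
      σ * U (-1) (Γ s₀ + n₀ • νΓ s₀ + z₀ • EuclideanSpace.single 2 (1 : ℝ)) 2 = R 0 z₀ ∧
      (∀ n ∈ Icc (-r) r, n ≠ n₀ → σ * U (-1) (Γ s₀ + n • νΓ s₀ + z₀ • EuclideanSpace.single 2 (1 : ℝ)) 2 < R 0 z₀))
    (hson : ∃ a b : ℝ, ∀ z : ℝ, |z| < δ → R 0 z = a + b * z)
    {e : EuclideanSpace ℝ (Fin 3)} (he2 : e 2 = 0) (hunit : e 0 ^ 2 + e 1 ^ 2 = 1) {d : ℝ → ℝ} {p : ℝ × ℝ}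
    (hd : DifferentiableAt ℝ d p.2) (hp : |p.2| < δ)
    (hGval : ∀ᶠ q in 𝓝 p, σ * U (-1) (webMap e (fun q : ℝ × ℝ => d q.2) q) 2 = R 0 q.2) :
    (Δ (fun x => U (-1) x 2)) (webMap e (fun q : ℝ × ℝ => d q.2) p) =
      (1 + deriv d p.2 ^ 2) * fderiv ℝ (fderiv ℝ (fun x => U (-1) x 2)) (webMap e (fun q : ℝ × ℝ => d q.2) p) (Jvec e) (Jvec e) := by
  obtain ⟨hsym, he, hz⟩ := sonic_sheet_null_tangents hUrate hUcont hUmild hUhotbd hσ hσN hΓhot hr hδ hweb hson e hd hp hGval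
  rw [laplacian_eq_sum_fderiv_fderiv_curried (EuclideanSpace.basisFun (Fin 3) ℝ) (fun x => U (-1) x 2) _, Fin.sum_univ_three]
  simp only [EuclideanSpace.basisFun_apply]
  exact bilin_trace_of_null_tangents _ hsym he2 hunit he hz

/-- **The Laplacian on the CHARACTERISTIC sheet:** with `d′(p₂)² + μ₀ = 0` (Huygens + sonic, `…Q4SonicLineFlat` step 1; `μ₀ = μ(−1,p₂)`),
`ΔU₂(−1,·)(W p) = (1 − μ₀)·D²U₂(−1,·)(W p)[Je][Je]`. -/
theorem sonic_sheet_laplacian_eq_of_char (hUrate : HasTypeITimeDecay C U) (hUcont : ContinuousOn (uncurry U) (Iio (0 : ℝ) ×ˢ univ))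
    (hUmild : ∀ s t : ℝ, s < t → t < 0 → ∀ x, U t x = heatExtension (U s) (t - s) x - oseenDuhamel 1 s U U t x)
    (hUhotbd : ∀ t < 0, ∀ x, Real.sqrt (-t) * |U t x 2| ≤ |U (-1) 0 2|)
    (hσ : σ = 1 ∨ σ = -1) (hσN : σ * U (-1) 0 2 = |U (-1) 0 2|) (hΓhot : ∀ s, U (-1) (Γ s) 2 = U (-1) 0 2)
    (hr : 0 < r) (hδ : 0 < δ)
    (hweb : ∀ z₀ : ℝ, |z₀| < δ → ∀ s₀ : ℝ, ∃ n₀ ∈ Ioo (-r) r,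
      σ * U (-1) (Γ s₀ + n₀ • νΓ s₀ + z₀ • EuclideanSpace.single 2 (1 : ℝ)) 2 = R 0 z₀ ∧
      (∀ n ∈ Icc (-r) r, n ≠ n₀ → σ * U (-1) (Γ s₀ + n • νΓ s₀ + z₀ • EuclideanSpace.single 2 (1 : ℝ)) 2 < R 0 z₀))
    (hson : ∃ a b : ℝ, ∀ z : ℝ, |z| < δ → R 0 z = a + b * z)
    {e : EuclideanSpace ℝ (Fin 3)} (he2 : e 2 = 0) (hunit : e 0 ^ 2 + e 1 ^ 2 = 1) {d : ℝ → ℝ} {p : ℝ × ℝ}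
    (hd : DifferentiableAt ℝ d p.2) (hp : |p.2| < δ)
    (hGval : ∀ᶠ q in 𝓝 p, σ * U (-1) (webMap e (fun q : ℝ × ℝ => d q.2) q) 2 = R 0 q.2) {μ₀ : ℝ} (hchar : deriv d p.2 ^ 2 + μ₀ = 0) :
    (Δ (fun x => U (-1) x 2)) (webMap e (fun q : ℝ × ℝ => d q.2) p) =
      (1 - μ₀) * fderiv ℝ (fderiv ℝ (fun x => U (-1) x 2)) (webMap e (fun q : ℝ × ℝ => d q.2) p) (Jvec e) (Jvec e) := by
  rw [sonic_sheet_laplacian_eq hUrate hUcont hUmild hUhotbd hσ hσN hΓhot hr hδ hweb hson he2 hunit hd hp hGval]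
  have h : deriv d p.2 ^ 2 = -μ₀ := by linarith
  rw [h]; ring

/-- ★ **THE SIGNED VERTICAL PRESSURE GRADIENT ON THE STRAIGHT SONIC SHEET, explicitly:** for every classical pressure `P` of the hull element on `t < 0`,
`σ·(∇P(−1,·))(W p)₂ = σ·(1 + d′(p₂)²)·D²U₂(−1,·)(W p)[Je][Je] − |N|/2` (`…TwistingTHHotPointPins.gradient_pressure_two_of_hotPoint` + `sonic_sheet_laplacian_eq`);
both terms are negative as soon as `σ·D²U₂(W p)[Je][Je] < 0` (strict transversal concavity of the web package). -/
theorem sonic_sheet_pressure_eq (hUrate : HasTypeITimeDecay C U) (hUcont : ContinuousOn (uncurry U) (Iio (0 : ℝ) ×ˢ univ))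
    (hUmild : ∀ s t : ℝ, s < t → t < 0 → ∀ x, U t x = heatExtension (U s) (t - s) x - oseenDuhamel 1 s U U t x)
    (hUdiv : ∀ t < 0, VectorCalculus.IsDivFree (U t))
    (hUne : U (-1) 0 2 ≠ 0) (hUhotbd : ∀ t < 0, ∀ x, Real.sqrt (-t) * |U t x 2| ≤ |U (-1) 0 2|)
    (hσ : σ = 1 ∨ σ = -1) (hσN : σ * U (-1) 0 2 = |U (-1) 0 2|) (hΓhot : ∀ s, U (-1) (Γ s) 2 = U (-1) 0 2)
    (hr : 0 < r) (hδ : 0 < δ)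
    (hweb : ∀ z₀ : ℝ, |z₀| < δ → ∀ s₀ : ℝ, ∃ n₀ ∈ Ioo (-r) r,
      σ * U (-1) (Γ s₀ + n₀ • νΓ s₀ + z₀ • EuclideanSpace.single 2 (1 : ℝ)) 2 = R 0 z₀ ∧
      (∀ n ∈ Icc (-r) r, n ≠ n₀ → σ * U (-1) (Γ s₀ + n • νΓ s₀ + z₀ • EuclideanSpace.single 2 (1 : ℝ)) 2 < R 0 z₀))
    (hson : ∃ a b : ℝ, ∀ z : ℝ, |z| < δ → R 0 z = a + b * z)
    {e : EuclideanSpace ℝ (Fin 3)} (he2 : e 2 = 0) (hunit : e 0 ^ 2 + e 1 ^ 2 = 1) {d : ℝ → ℝ} {p : ℝ × ℝ}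
    (hd : DifferentiableAt ℝ d p.2) (hp : |p.2| < δ)
    (hGval : ∀ᶠ q in 𝓝 p, σ * U (-1) (webMap e (fun q : ℝ × ℝ => d q.2) q) 2 = R 0 q.2)
    {P : ℝ → EuclideanSpace ℝ (Fin 3) → ℝ} (hP : IsClassicalNSSolutionOn (Iio 0) 1 0 U P) :
    σ * gradient (P (-1)) (webMap e (fun q : ℝ × ℝ => d q.2) p) 2 =
        σ * ((1 + deriv d p.2 ^ 2) * fderiv ℝ (fderiv ℝ (fun x => U (-1) x 2)) (webMap e (fun q : ℝ × ℝ => d q.2) p) (Jvec e) (Jvec e)) -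
          |U (-1) 0 2| / 2 ∧
      (σ * fderiv ℝ (fderiv ℝ (fun x => U (-1) x 2)) (webMap e (fun q : ℝ × ℝ => d q.2) p) (Jvec e) (Jvec e) < 0 →
        σ * gradient (P (-1)) (webMap e (fun q : ℝ × ℝ => d q.2) p) 2 < -|U (-1) 0 2| / 2) := by
  have hσ0 := sigma_ne_zero hσ
  set y := webMap e (fun q : ℝ × ℝ => d q.2) p with hy
  -- `y` is a hot point
  have hval : σ * U (-1) y 2 = |U (-1) 0 2| := by
    rw [hGval.self_of_nhds, sonic_ridge_height_const hUhotbd hσ hσN hΓhot hr hδ hweb hson p.2 hp]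
  have hhot : U (-1) y 2 = U (-1) 0 2 := by
    rw [← hσN] at hval
    exact mul_left_cancel₀ hσ0 hval
  have heq := gradient_pressure_two_of_hotPoint hUrate hUcont hUmild hUdiv hUne hUhotbd hhot hP
  have hlap := sonic_sheet_laplacian_eq hUrate hUcont hUmild hUhotbd hσ hσN hΓhot hr hδ hweb hson he2 hunit hd hp hGval
  have h1 : σ * gradient (P (-1)) y 2 =
      σ * ((1 + deriv d p.2 ^ 2) * fderiv ℝ (fderiv ℝ (fun x => U (-1) x 2)) y (Jvec e) (Jvec e)) - |U (-1) 0 2| / 2 := by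
    rw [heq, ← hlap, mul_sub, ← hσN]; ring
  refine ⟨h1, fun hneg => ?_⟩
  rw [h1]
  have hpos : 0 < |U (-1) 0 2| := abs_pos.2 hUne
  nlinarith [hneg, sq_nonneg (deriv d p.2)]

/-! ### Part C — any branch, point level: the velocity gradient at a sonic web point -/

/-- **THE VELOCITY GRADIENT AT A SONIC WEB POINT is a horizontal, symmetric, trace-free `2×2` block:** `DU(−1)(W)e₂ = 0` (slab slope law + gradient pin),
`(DU(−1)(W)h)₂ = 0` (gradient pin), `(DU(W)e₀)₁ = (DU(W)e₁)₀` (poloidality), `(DU(W)e₀)₀ + (DU(W)e₁)₁ = 0` (incompressibility + `∂₂U₂ = 0`). -/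
theorem sonic_web_point_fderiv_structure (hUrate : HasTypeITimeDecay C U) (hUcont : ContinuousOn (uncurry U) (Iio (0 : ℝ) ×ˢ univ))
    (hUmild : ∀ s t : ℝ, s < t → t < 0 → ∀ x, U t x = heatExtension (U s) (t - s) x - oseenDuhamel 1 s U U t x)
    (hUdiv : ∀ t < 0, VectorCalculus.IsDivFree (U t))
    (hUpol : ∀ s < 0, ∀ q, ⟪curl (U s) q, EuclideanSpace.single 2 1⟫_ℝ = 0)
    (hUhotbd : ∀ t < 0, ∀ x, Real.sqrt (-t) * |U t x 2| ≤ |U (-1) 0 2|)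
    (hσ : σ = 1 ∨ σ = -1) (hσN : σ * U (-1) 0 2 = |U (-1) 0 2|)
    (hΓ2 : ∀ s, Γ s 2 = 0) (hΓhot : ∀ s, U (-1) (Γ s) 2 = U (-1) 0 2)
    (hν : ∀ s, νΓ s = WithLp.toLp 2 ![-(deriv Γ s 1), deriv Γ s 0, 0])
    (hr : 0 < r) (hδ : 0 < δ)
    (hweb : ∀ z₀ : ℝ, |z₀| < δ → ∀ s₀ : ℝ, ∃ n₀ ∈ Ioo (-r) r,
      σ * U (-1) (Γ s₀ + n₀ • νΓ s₀ + z₀ • EuclideanSpace.single 2 (1 : ℝ)) 2 = R 0 z₀ ∧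
      (∀ n ∈ Icc (-r) r, n ≠ n₀ → σ * U (-1) (Γ s₀ + n • νΓ s₀ + z₀ • EuclideanSpace.single 2 (1 : ℝ)) 2 < R 0 z₀))
    {ρ : ℝ} {μ : ℝ → ℝ → ℝ} (hρ : 0 < ρ)
    (hslabU : ∀ t : ℝ, |t + 1| < ρ → ∀ x : EuclideanSpace ℝ (Fin 3), |x 2| < ρ → ∀ b : Fin 3, b ≠ 2 →
      fderiv ℝ (U t) x (EuclideanSpace.single 2 1) b = μ t (x 2) * fderiv ℝ (U t) x (EuclideanSpace.single b 1) 2)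
    (hson : ∃ a b : ℝ, ∀ z : ℝ, |z| < δ → R 0 z = a + b * z) {z : ℝ} (hz : |z| < δ) (hzρ : |z| < ρ) (s : ℝ) {n₀ : ℝ}
    (hn₀ : σ * U (-1) (Γ s + n₀ • νΓ s + z • EuclideanSpace.single 2 (1 : ℝ)) 2 = R 0 z) :
    fderiv ℝ (U (-1)) (Γ s + n₀ • νΓ s + z • EuclideanSpace.single 2 (1 : ℝ)) (EuclideanSpace.single 2 1) = 0 ∧
      (∀ h, fderiv ℝ (U (-1)) (Γ s + n₀ • νΓ s + z • EuclideanSpace.single 2 (1 : ℝ)) h 2 = 0) ∧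
      fderiv ℝ (U (-1)) (Γ s + n₀ • νΓ s + z • EuclideanSpace.single 2 (1 : ℝ)) (EuclideanSpace.single 0 1) 1 =
        fderiv ℝ (U (-1)) (Γ s + n₀ • νΓ s + z • EuclideanSpace.single 2 (1 : ℝ)) (EuclideanSpace.single 1 1) 0 ∧
      fderiv ℝ (U (-1)) (Γ s + n₀ • νΓ s + z • EuclideanSpace.single 2 (1 : ℝ)) (EuclideanSpace.single 0 1) 0 +
        fderiv ℝ (U (-1)) (Γ s + n₀ • νΓ s + z • EuclideanSpace.single 2 (1 : ℝ)) (EuclideanSpace.single 1 1) 1 = 0 := by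
  set W : EuclideanSpace ℝ (Fin 3) := Γ s + n₀ • νΓ s + z • EuclideanSpace.single 2 (1 : ℝ) with hW
  have hm1 : (-1 : ℝ) < 0 := by norm_num
  have hy : U (-1) W 2 = U (-1) 0 2 := sonic_web_point_eq hUhotbd hσ hσN hΓhot hr hδ hweb hson hz s hn₀
  have hgrad : ∀ h : EuclideanSpace ℝ (Fin 3), fderiv ℝ (U (-1)) W h 2 = 0 :=
    fun h => gradPin_of_hotPoint hUrate hUcont hUmild hUdiv hUhotbd hy h
  have hW2 : W 2 = z := by simp [hW, hΓ2 s, hν s]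
  have hslope : ∀ b : Fin 3, b ≠ 2 → fderiv ℝ (U (-1)) W (EuclideanSpace.single 2 1) b = 0 := by
    intro b hb
    rw [hslabU (-1) (by simp [hρ]) W (by rw [hW2]; exact hzρ) b hb, hgrad, mul_zero]
  refine ⟨?_, hgrad, ?_, ?_⟩
  · ext i
    rw [PiLp.zero_apply]
    fin_cases i
    · exact hslope 0 (by decide)
    · exact hslope 1 (by decide)
    · exact hgrad _
  · have h := hUpol (-1) hm1 W
    rw [EuclideanSpace.inner_single_right] at h
    have h2 : curl (U (-1)) W 2 = 0 := by simpa using h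
    simp only [curl] at h2
    have h3 : fderiv ℝ (U (-1)) W (EuclideanSpace.single 0 1) 1 - fderiv ℝ (U (-1)) W (EuclideanSpace.single 1 1) 0 = 0 := by
      simpa using h2
    linarith
  · have h := div_coord (hUdiv (-1) hm1) W
    rw [hgrad] at h
    linarith

end Summit.NavierStokesRegularity.NavierStokesRegularity.Theorems.PoloidalWindowDoorLrcModEntireQ4SonicHotSheetNormalForm

end
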